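import Literature.Analysis.FluidPDE.OnsagerFlexibilityAssembly
import Literature.Analysis.FluidPDE.OnsagerBDSVOscillationPrincipalProofs
import Literature.Analysis.FluidPDE.OnsagerBDSVCommutatorHolds
import Literature.Analysis.FluidPDE.OnsagerBDSVTransportErrorHolds
import Literature.Analysis.FluidPDE.OnsagerBDSVGluingStabilityHolds
import Literature.Analysis.FluidPDE.EulerTorusShortTimeProofs
import HarnessLib

/-!
# Dissipative Hölder Euler flows below `1/3`: discharge of `onsager_flexibility_strictAntiOn`

Buckmaster–De Lellis–Székelyhidi–Vicol (BDSV), *Onsager's conjecture for admissible weak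
solutions*, Comm. Pure Appl. Math. **72** (2019) 229–274 = arXiv:1701.08678, Thm. 1.1 (arXiv
p. 3): "Assume `e : [0,T] → ℝ` is a strictly positive smooth function. Then for any `0 < β < 1/3`
there exists a weak solution `v ∈ C^β(T³ × [0,T])` [of incompressible Euler] with
`∫_{T³} |v(x,t)|² dx = e(t)`." Applied to a strictly decreasing profile this is the named fact
`Literature.Analysis.FluidPDE.onsager_flexibility_strictAntiOn` of `Onsager.lean` (for every
`α < 1/3` and `T > 0` a weak Euler solution on `T³`, `α`-Hölder on `[0,T] × T³`, whose kinetic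
energy is strictly decreasing on `[0,T]`); the reduction to Thm. 1.1 with the profile
`e(t) = T + 1 - t` is the proved `onsager_flexibility_strictAntiOn_of` (`Onsager.lean`).

This file PROVES the fact (`onsager_flexibility_strictAntiOn_holds`) by composing the tree's
proved assembly of Thm. 1.1 down to four named facts
(`onsager_flexibility_strictAntiOn_of_remaining`, `OnsagerFlexibilityAssembly.lean`: §2.2 and
Prop. 2.1 through `BDSV.mainIteration_of_remaining`, the mollification stage, the time-regularity
step and the §§2.5–2.6, §5 assemblies being proved there) with the discharges of those facts,
all now in the tree:

* `Torus.eulerSmoothShortTime_holds` (`EulerTorusShortTimeProofs.lean`: short-time smooth Euler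
  solutions on `T³`, Majda–Bertozzi Thm. 3.4, used in Prop. 3.1);
* `BDSV.gluingStability_holds` (`OnsagerBDSVGluingStabilityHolds.lean`: §3, Cor. 3.2,
  Props. 3.3–3.4);
* `BDSV.gluedTripleEstimates_holds` (`OnsagerBDSVCommutatorHolds.lean`: §4, Props. 4.1–4.4, via
  the commutator estimate App. D Prop. D.1, `BDSV.commutatorCZBound_holds`);
* Prop. 6.1 (`BDSV.stressEstimate`) by the proved split `BDSV.stressEstimate_of_errors`
  (`OnsagerBDSVStressSplit.lean`) from the three error estimates of §6.1: the Nash error (6.5)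
  `BDSV.nashErrorEstimate_holds` (`OnsagerBDSVNashErrorProof.lean`), the transport error (6.8)
  `BDSV.transportErrorEstimate_holds` (`OnsagerBDSVTransportErrorHolds.lean`) and the
  oscillation error (6.12) `BDSV.oscillationErrorEstimate_holds`
  (`OnsagerBDSVOscillationPrincipalProofs.lean`).

Nothing new is asserted: the file contains one theorem, a composition of proved theorems (no
definitions, no named facts). Remark on the docstring of the fact: its parenthetical "dissipative
form; Isett 2018 Thm 1" is loose — the flows of Isett (Ann. Math. 188 (2018)) are only shown to be
non-conservative ("for those solutions the total kinetic energy fails to be monotonic on any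
interval of time", BDSV p. 3); the strictly dissipative form at every exponent below `1/3` is
BDSV Thm. 1.1, which is what is proved here.

## Main statements

* `onsager_flexibility_strictAntiOn_holds : onsager_flexibility_strictAntiOn`.

## References

* T. Buckmaster, C. De Lellis, L. Székelyhidi Jr., V. Vicol, *Onsager's conjecture for admissible
  weak solutions*, Comm. Pure Appl. Math. 72 (2019) 229–274 = arXiv:1701.08678, Thm. 1.1 (p. 3)
  and its proof (§2.2 from Prop. 2.1; §§3–6, App. A–D). [`BuckmasterEtAl2018`]
* P. Isett, *A proof of Onsager's conjecture*, Ann. of Math. 188 (2018) 871–963, Thm. 1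
  (non-conservative flows; the comparison above).
-/

namespace Literature.Analysis.FluidPDE

/-- **Dissipative Hölder-continuous Euler flows on `T³` for every exponent below `1/3`**
(discharge of the named fact `onsager_flexibility_strictAntiOn`): for every `α < 1/3` and every
`T > 0` there is a weak solution of incompressible Euler on the flat 3-torus which is `α`-Hölder
on `[0,T] × T³` and whose kinetic energy `½∫|u(t)|²` is strictly decreasing on `[0,T]`. This is
BDSV Thm. 1.1 ("Assume `e : [0,T] → ℝ` is a strictly positive smooth function. Then for any
`0 < β < 1/3` there exists a weak solution `v ∈ C^β(T³ × [0,T])` with `∫|v(x,t)|² dx = e(t)`")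
for the strictly decreasing profile `e(t) = T + 1 - t` (`onsager_flexibility_strictAntiOn_of`),
Thm. 1.1 itself being assembled from its proved parts by
`onsager_flexibility_strictAntiOn_of_remaining` fed with `Torus.eulerSmoothShortTime_holds`
(Prop. 3.1 input), `BDSV.gluingStability_holds` (§3), `BDSV.gluedTripleEstimates_holds` (§4) and
Prop. 6.1 in the form `BDSV.stressEstimate_of_errors BDSV.nashErrorEstimate_holds
BDSV.transportErrorEstimate_holds BDSV.oscillationErrorEstimate_holds` (§6.1).
[cite: BuckmasterEtAl2018, Thm. 1.1] -/
theorem onsager_flexibility_strictAntiOn_holds : onsager_flexibility_strictAntiOn :=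
  onsager_flexibility_strictAntiOn_of_remaining Torus.eulerSmoothShortTime_holds
    BDSV.gluingStability_holds BDSV.gluedTripleEstimates_holds
    (BDSV.stressEstimate_of_errors BDSV.nashErrorEstimate_holds BDSV.transportErrorEstimate_holds
      BDSV.oscillationErrorEstimate_holds)

end Literature.Analysis.FluidPDE
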